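import Literature.Geometry.Lorentzian.DecaySymbolsSqrt
import Literature.Geometry.Lorentzian.KerrSchildDivergence
import HarnessLib

/-!
# Decay of the Kerr–Schild functions on the slices `{t* = const}` (all spins)

On the slice `{t* = 0}` of the ingoing Kerr–Schild chart, identified with `E3` through
`z ↦ (0, z)`, the building blocks of the Kerr metric `g = η + 2H ℓ ⊗ ℓ` are smooth symbols at
infinity (`IsBigOSmooth`, `DecaySymbols.lean`) of the expected orders, **for every value of the
spin parameter `a`** (and every real `M`):

* the Kerr–Schild radius: `r² = ρ² F` with `ρ = ‖z‖` and
  `F = ½ (u + √(u² + 4v))`, `u = 1 − a²/ρ²`, `v = a² z₃²/ρ⁴` (`Kerr.radius_sq_ofTimeSpace_eq`), so that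
  `F → 1`, `F ∈ O_k(1)`, `r ∈ O_k(ρ)` and `1/r ∈ O_k(ρ⁻¹)` (`Kerr.isBigOSmooth_radius_ofTimeSpace`,
  `Kerr.isBigOSmooth_inv_radius_ofTimeSpace`);
* `H = M r³/(r⁴ + a² z²) = (M/r)(1 + a² z₃²/r⁴)⁻¹ ∈ O_k(ρ⁻¹)` (`Kerr.isBigOSmooth_scalarH_ofTimeSpace`);
* the components `ℓ_μ` of the null covector, `(1, (r x + a y)/(r² + a²), (r y − a x)/(r² + a²), z/r)`,
  are in `O_k(1)` (`Kerr.isBigOSmooth_nullCovectorFun_ofTimeSpace`), hence so are `ℓ`, `ℓ♯`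
  (`Kerr.isBigOSmooth_nullCovector_ofTimeSpace`, `Kerr.isBigOSmooth_nullVector_ofTimeSpace`);
* consequently `g − η = 2H ℓ ⊗ ℓ ∈ O_k(ρ⁻¹)` (`Kerr.isBigOSmooth_bilin_sub_ofTimeSpace`),
  `V − ∂_{t*} = −2H ℓ♯ ∈ O_k(ρ⁻¹)` for `V = −g♯dt*` (`Kerr.isBigOSmooth_timeVector_sub_ofTimeSpace`),
  and the unit normal `ν = (1 + 2H)^{-1/2} V` of the slice satisfies `ν ∈ O_k(1)`,
  `ν − ∂_{t*} ∈ O_k(ρ⁻¹)` (`Kerr.isBigOSmooth_sliceNormalRep_sub_ofTimeSpace`).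

These are the inputs of the asymptotic flatness of the Kerr–Schild slice data
(`KerrDataAsymptoticFlatness.lean`): `h − δ = 2H ℓ⃗ ⊗ ℓ⃗ = O₂(ρ⁻¹)`, `k = O₁(ρ⁻²)`. Cook, Living
Rev. Relativ. 3 (2000) 5, §3.2.2; García-Parrado–Valiente Kroon, J. Geom. Phys. 58 (2008), §5;
Visser arXiv:0706.0622, (32)–(35). Everything is proved (symbol calculus of
`DecaySymbols*.lean`); no definitions, no named facts.

## References

* M. Visser, *The Kerr spacetime: a brief introduction*, arXiv:0706.0622, §4, (32)–(35).
* G. B. Cook, *Initial data for numerical relativity*, Living Rev. Relativ. 3 (2000) 5, §3.2.2.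
* A. García-Parrado, J. A. Valiente Kroon, *Kerr initial data*, J. Geom. Phys. 58 (2008), §5.
-/

noncomputable section

open Set Filter Asymptotics Bornology Topology
open scoped ContDiff RealInnerProductSpace

namespace Literature.Geometry.Lorentzian

namespace Kerr

/-! ### Coordinates and powers of `1/ρ` -/

/-- The coordinate functions `z ↦ zᵢ` of `E3` are symbols of order `1`. [folklore] -/
theorem isBigOSmooth_coord (i : Fin 3) (k : ℕ) : IsBigOSmooth k 1 fun z : E3 ↦ z i :=
  (isBigOSmooth_clm_apply (EuclideanSpace.proj (𝕜 := ℝ) i : E3 →L[ℝ] ℝ) k).congr fun _ ↦ rfl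

/-- `ρ⁻² ∈ O_k(ρ⁻²)`. [folklore] -/
theorem isBigOSmooth_inv_norm_sq (k : ℕ) : IsBigOSmooth k (-2) fun z : E3 ↦ ‖z‖⁻¹ ^ 2 := by
  simpa using isBigOSmooth_inv_norm_pow (E' := E3) k 2

/-- `ρ⁻⁴ ∈ O_k(ρ⁻⁴)`. [folklore] -/
theorem isBigOSmooth_inv_norm_four (k : ℕ) : IsBigOSmooth k (-4) fun z : E3 ↦ ‖z‖⁻¹ ^ 4 := by
  simpa using isBigOSmooth_inv_norm_pow (E' := E3) k 4

/-- The first spatial coordinate of `(0, z)` is `z₁`. [folklore] -/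
theorem ofTimeSpace_zero_apply_one (z : E3) : E4.ofTimeSpace 0 z 1 = z 0 :=
  E4.ofTimeSpace_apply_succ 0 z 0

/-- The second spatial coordinate of `(0, z)` is `z₂`. [folklore] -/
theorem ofTimeSpace_zero_apply_two (z : E3) : E4.ofTimeSpace 0 z 2 = z 1 :=
  E4.ofTimeSpace_apply_succ 0 z 1

/-- The third coordinate of `(0, z)` is `z₃`. [folklore] -/
theorem ofTimeSpace_zero_apply_three (z : E3) : E4.ofTimeSpace 0 z 3 = z 2 :=
  E4.ofTimeSpace_apply_succ 0 z 2

/-! ### The radius -/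

section Radius

variable (a : ℝ)

/-- `u = 1 − a²/ρ² ∈ O_k(1)`. [cite: arXiv07060622, (35)] -/
theorem isBigOSmooth_radiusU (k : ℕ) : IsBigOSmooth k 0 fun z : E3 ↦ 1 - a ^ 2 * ‖z‖⁻¹ ^ 2 :=
  (isBigOSmooth_const k (1 : ℝ)).sub
    (((isBigOSmooth_inv_norm_sq k).const_mul (a ^ 2)).mono (by norm_num))

/-- `u = 1 − a²/ρ² → 1`. [cite: arXiv07060622, (35)] -/
theorem tendsto_radiusU : Tendsto (fun z : E3 ↦ 1 - a ^ 2 * ‖z‖⁻¹ ^ 2) (cobounded E3) (𝓝 1) := by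
  have h := ((isBigOSmooth_inv_norm_sq 0).const_mul (a ^ 2)).tendsto_zero (by norm_num)
  simpa using tendsto_const_nhds.sub h

/-- `v = a² z₃²/ρ⁴ ∈ O_k(ρ⁻²)`. [cite: arXiv07060622, (35)] -/
theorem isBigOSmooth_radiusV (k : ℕ) :
    IsBigOSmooth k (-2) fun z : E3 ↦ a ^ 2 * (z 2 ^ 2 * ‖z‖⁻¹ ^ 4) := by
  have h := (((isBigOSmooth_coord 2 k).mul (isBigOSmooth_coord 2 k)).mul
    (isBigOSmooth_inv_norm_four k)).const_mul (a ^ 2)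
  rw [show (1 : ℝ) + 1 + -4 = -2 by norm_num] at h
  exact h.congr fun z ↦ by ring

/-- The discriminant `u² + 4v ∈ O_k(1)`. [cite: arXiv07060622, (35)] -/
theorem isBigOSmooth_radiusDiscr (k : ℕ) : IsBigOSmooth k 0 fun z : E3 ↦
    (1 - a ^ 2 * ‖z‖⁻¹ ^ 2) ^ 2 + 4 * (a ^ 2 * (z 2 ^ 2 * ‖z‖⁻¹ ^ 4)) :=
  ((isBigOSmooth_radiusU a k).pow 2).add (((isBigOSmooth_radiusV a k).mono (by norm_num)).const_mul 4)

/-- `u² + 4v → 1`. [cite: arXiv07060622, (35)] -/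
theorem tendsto_radiusDiscr : Tendsto (fun z : E3 ↦
    (1 - a ^ 2 * ‖z‖⁻¹ ^ 2) ^ 2 + 4 * (a ^ 2 * (z 2 ^ 2 * ‖z‖⁻¹ ^ 4))) (cobounded E3) (𝓝 1) := by
  have hu := (tendsto_radiusU a).pow 2
  have hv := ((isBigOSmooth_radiusV a 0).tendsto_zero (by norm_num)).const_mul 4
  simpa using hu.add hv

/-- The factor `F = ½ (u + √(u² + 4v))` with `r² = ρ² F` is a symbol of order `0`.
[cite: arXiv07060622, (35)] -/
theorem isBigOSmooth_radiusF (k : ℕ) : IsBigOSmooth k 0 fun z : E3 ↦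
    (1 - a ^ 2 * ‖z‖⁻¹ ^ 2 +
      √((1 - a ^ 2 * ‖z‖⁻¹ ^ 2) ^ 2 + 4 * (a ^ 2 * (z 2 ^ 2 * ‖z‖⁻¹ ^ 4)))) / 2 := by
  have h := ((isBigOSmooth_radiusU a k).add
    ((isBigOSmooth_radiusDiscr a k).sqrt (tendsto_radiusDiscr a))).const_mul 2⁻¹
  exact h.congr fun z ↦ by ring

/-- `F → 1`. [cite: arXiv07060622, (35)] -/
theorem tendsto_radiusF : Tendsto (fun z : E3 ↦
    (1 - a ^ 2 * ‖z‖⁻¹ ^ 2 +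
      √((1 - a ^ 2 * ‖z‖⁻¹ ^ 2) ^ 2 + 4 * (a ^ 2 * (z 2 ^ 2 * ‖z‖⁻¹ ^ 4)))) / 2)
    (cobounded E3) (𝓝 1) := by
  have h := ((tendsto_radiusU a).add
    (IsBigOSmooth.tendsto_sqrt_one (tendsto_radiusDiscr a))).mul_const 2⁻¹
  rw [show ((1 : ℝ) + 1) * 2⁻¹ = 1 by norm_num] at h
  exact h.congr fun z ↦ by ring

/-- **`r² = ρ² F`**: the square of the Kerr–Schild radius at `(0, z)`, `z ≠ 0`, is
`‖z‖² · ½ (u + √(u² + 4v))` with `u = 1 − a²/‖z‖²`, `v = a² z₃²/‖z‖⁴` (Visser arXiv:0706.0622,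
(35), divided by `ρ⁴`). [cite: arXiv07060622, (35)] -/
theorem radius_sq_ofTimeSpace_eq {z : E3} (hz : z ≠ 0) :
    radius a (E4.ofTimeSpace 0 z) ^ 2 = ‖z‖ ^ 2 *
      ((1 - a ^ 2 * ‖z‖⁻¹ ^ 2 +
        √((1 - a ^ 2 * ‖z‖⁻¹ ^ 2) ^ 2 + 4 * (a ^ 2 * (z 2 ^ 2 * ‖z‖⁻¹ ^ 4)))) / 2) := by
  have hρ : 0 < ‖z‖ := norm_pos_iff.2 hz
  have hρ0 : ‖z‖ ≠ 0 := hρ.ne'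
  rw [radius_sq, E4.spatialNorm_ofTimeSpace, ofTimeSpace_zero_apply_three]
  -- the discriminant is `ρ⁴ (u² + 4v)`
  have hdisc : (‖z‖ ^ 2 - a ^ 2) ^ 2 + 4 * a ^ 2 * z 2 ^ 2 =
      (‖z‖ ^ 2) ^ 2 * ((1 - a ^ 2 * ‖z‖⁻¹ ^ 2) ^ 2 + 4 * (a ^ 2 * (z 2 ^ 2 * ‖z‖⁻¹ ^ 4))) := by
    field_simp
  have hnn : 0 ≤ (1 - a ^ 2 * ‖z‖⁻¹ ^ 2) ^ 2 + 4 * (a ^ 2 * (z 2 ^ 2 * ‖z‖⁻¹ ^ 4)) := by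
    positivity
  rw [hdisc, Real.sqrt_mul (by positivity), Real.sqrt_sq (by positivity)]
  field_simp

/-- `F ≥ 0` (indeed `√(u² + 4v) ≥ |u|`). [cite: arXiv07060622, (35)] -/
theorem radiusF_nonneg (z : E3) :
    0 ≤ (1 - a ^ 2 * ‖z‖⁻¹ ^ 2 +
      √((1 - a ^ 2 * ‖z‖⁻¹ ^ 2) ^ 2 + 4 * (a ^ 2 * (z 2 ^ 2 * ‖z‖⁻¹ ^ 4)))) / 2 := by
  have h1 : |1 - a ^ 2 * ‖z‖⁻¹ ^ 2| ≤
      √((1 - a ^ 2 * ‖z‖⁻¹ ^ 2) ^ 2 + 4 * (a ^ 2 * (z 2 ^ 2 * ‖z‖⁻¹ ^ 4))) := by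
    rw [← Real.sqrt_sq_eq_abs]
    exact Real.sqrt_le_sqrt (by nlinarith [sq_nonneg (a * (z 2 * ‖z‖⁻¹ ^ 2))])
  linarith [neg_abs_le (1 - a ^ 2 * ‖z‖⁻¹ ^ 2)]

/-- **`r = ρ √F`** at `(0, z)`, `z ≠ 0`. [cite: arXiv07060622, (35)] -/
theorem radius_ofTimeSpace_eq_norm_mul {z : E3} (hz : z ≠ 0) :
    radius a (E4.ofTimeSpace 0 z) = ‖z‖ *
      √((1 - a ^ 2 * ‖z‖⁻¹ ^ 2 +
        √((1 - a ^ 2 * ‖z‖⁻¹ ^ 2) ^ 2 + 4 * (a ^ 2 * (z 2 ^ 2 * ‖z‖⁻¹ ^ 4)))) / 2) := by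
  rw [← Real.sqrt_sq (radius_nonneg a _), radius_sq_ofTimeSpace_eq a hz,
    Real.sqrt_mul (sq_nonneg _), Real.sqrt_sq (norm_nonneg _)]

/-- **The Kerr–Schild radius restricted to a slice is a symbol of order `1`**: `r = ρ √F` with
`√F ∈ O_k(1)` (`F → 1`). [cite: arXiv07060622, (35)] -/
theorem isBigOSmooth_radius_ofTimeSpace (k : ℕ) :
    IsBigOSmooth k 1 fun z : E3 ↦ radius a (E4.ofTimeSpace 0 z) := by
  have h := (isBigOSmooth_norm (E' := E3) k).mul
    ((isBigOSmooth_radiusF a k).sqrt (tendsto_radiusF a))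
  rw [add_zero] at h
  refine h.congr_far (R₁ := 0) fun z hz ↦ ?_
  exact (radius_ofTimeSpace_eq_norm_mul a (norm_pos_iff.1 hz)).symm

/-- `r/ρ = √F → 1`: the Kerr–Schild radius is asymptotic to the Euclidean one.
[cite: arXiv07060622, (35)] -/
theorem tendsto_radius_div_norm :
    Tendsto (fun z : E3 ↦ radius a (E4.ofTimeSpace 0 z) * ‖z‖⁻¹) (cobounded E3) (𝓝 1) := by
  have h := IsBigOSmooth.tendsto_sqrt_one (tendsto_radiusF a)
  refine h.congr' ?_
  filter_upwards [eventually_cobounded_lt_norm (E := E3) 0] with z hz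
  rw [radius_ofTimeSpace_eq_norm_mul a (norm_pos_iff.1 hz)]
  field_simp

/-- Far out the Kerr–Schild radius is positive on the slice (indeed `r/ρ → 1`).
[cite: arXiv07060622, (35)] -/
theorem eventually_radius_ofTimeSpace_pos :
    ∀ᶠ z in cobounded E3, 0 < radius a (E4.ofTimeSpace 0 z) := by
  filter_upwards [(tendsto_radius_div_norm a).eventually (Ioi_mem_nhds (by norm_num : (1 / 2 : ℝ) < 1)),
    eventually_cobounded_lt_norm (E := E3) 0] with z hz hρ
  have h : 0 < radius a (E4.ofTimeSpace 0 z) * ‖z‖⁻¹ := lt_trans one_half_pos hz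
  exact (radius_nonneg a _).lt_of_ne fun h0 ↦ by
    rw [← h0, zero_mul] at h
    exact lt_irrefl 0 h

end Radius

/-! ### Vector-valued symbols from their components -/

/-- A map into `E4` whose coordinate components are symbols is a symbol (expansion in the
standard basis). [folklore] -/
theorem _root_.Literature.Geometry.Lorentzian.IsBigOSmooth.of_apply_E4 {k : ℕ} {b : ℝ}
    {f : E3 → E4} (hf : ∀ μ, IsBigOSmooth k b fun z ↦ f z μ) : IsBigOSmooth k b f := by
  have h : IsBigOSmooth k b fun z ↦ ∑ μ, f z μ • E4.basisVector μ :=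
    IsBigOSmooth.finset_sum _ fun μ _ ↦ (hf μ).smul_const _
  refine h.congr fun z ↦ ?_
  ext ν
  simp [E4.basisVector, Pi.single_apply]

/-! ### The inverse radius and `H` -/

section ScalarH

variable (M a : ℝ)

/-- **`1/r ∈ O_k(ρ⁻¹)`** on the slice: `1/r = ρ⁻¹ (√F)⁻¹` with `√F → 1`.
[cite: arXiv07060622, (35)] -/
theorem isBigOSmooth_inv_radius_ofTimeSpace (k : ℕ) :
    IsBigOSmooth k (-1) fun z : E3 ↦ (radius a (E4.ofTimeSpace 0 z))⁻¹ := by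
  have hs := ((isBigOSmooth_radiusF a k).sqrt (tendsto_radiusF a)).inv
    (IsBigOSmooth.tendsto_sqrt_one (tendsto_radiusF a))
  have h := (isBigOSmooth_inv_norm_all (E' := E3) k).mul hs
  rw [add_zero] at h
  refine h.congr_far (R₁ := 0) fun z hz ↦ ?_
  rw [radius_ofTimeSpace_eq_norm_mul a (norm_pos_iff.1 hz), mul_inv]

/-- `r⁻ⁿ ∈ O_k(ρ⁻ⁿ)` on the slice. [cite: arXiv07060622, (35)] -/
theorem isBigOSmooth_inv_radius_pow_ofTimeSpace (k n : ℕ) :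
    IsBigOSmooth k (-(n : ℝ)) fun z : E3 ↦ (radius a (E4.ofTimeSpace 0 z))⁻¹ ^ n := by
  induction n with
  | zero => simpa using isBigOSmooth_const (E := E3) k (1 : ℝ)
  | succ n ih =>
      have h := ih.mul (isBigOSmooth_inv_radius_ofTimeSpace a k)
      rw [show (-(n : ℝ)) + -1 = -((n + 1 : ℕ) : ℝ) by push_cast; ring] at h
      exact h.congr fun y ↦ by rw [pow_succ]

/-- **`H ∈ O_k(ρ⁻¹)` on the slice**, for every spin: far out `r > 0` and
`H = M r³/(r⁴ + a² z₃²) = M r⁻¹ (1 + a² z₃² r⁻⁴)⁻¹` with `a² z₃² r⁻⁴ ∈ O_k(ρ⁻²)`, `→ 0`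
(Visser arXiv:0706.0622, (33); Cook 2000, §3.2.2: `H = M/r + O(r⁻³)`).
[cite: arXiv07060622, (33)] -/
theorem isBigOSmooth_scalarH_ofTimeSpace (k : ℕ) :
    IsBigOSmooth k (-1) fun z : E3 ↦ scalarH M a (E4.ofTimeSpace 0 z) := by
  -- `w = a² z₃² r⁻⁴ ∈ O_k(ρ⁻²)`
  have hw : IsBigOSmooth k (-2) fun z : E3 ↦
      a ^ 2 * (z 2 ^ 2 * (radius a (E4.ofTimeSpace 0 z))⁻¹ ^ 4) := by
    have h := (((isBigOSmooth_coord 2 k).mul (isBigOSmooth_coord 2 k)).mul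
      (isBigOSmooth_inv_radius_pow_ofTimeSpace a k 4)).const_mul (a ^ 2)
    rw [show (1 : ℝ) + 1 + -((4 : ℕ) : ℝ) = -2 by norm_num] at h
    exact h.congr fun z ↦ by ring
  have hw1 : Tendsto (fun z : E3 ↦ 1 + a ^ 2 * (z 2 ^ 2 * (radius a (E4.ofTimeSpace 0 z))⁻¹ ^ 4))
      (cobounded E3) (𝓝 1) := hw.tendsto_const_add (by norm_num) 1
  have hinv := ((isBigOSmooth_const k (1 : ℝ)).add (hw.mono (by norm_num))).inv hw1
  have h := (((isBigOSmooth_const k M).mul (isBigOSmooth_inv_radius_ofTimeSpace a k)).mul hinv)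
  rw [show (0 : ℝ) + -1 + 0 = -1 by norm_num] at h
  obtain ⟨R₁, hR₁⟩ := exists_radius_of_eventually_cobounded (eventually_radius_ofTimeSpace_pos a)
  refine h.congr_far (R₁ := R₁) fun z hz ↦ ?_
  have hr : 0 < radius a (E4.ofTimeSpace 0 z) := hR₁ z hz
  have hr0 : radius a (E4.ofTimeSpace 0 z) ≠ 0 := hr.ne'
  rw [scalarH, ofTimeSpace_zero_apply_three]
  have hden : radius a (E4.ofTimeSpace 0 z) ^ 4 + a ^ 2 * z 2 ^ 2 ≠ 0 := by positivity
  field_simp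

/-- `H → 0` at infinity along the slice. [cite: arXiv07060622, (33)] -/
theorem tendsto_scalarH_ofTimeSpace :
    Tendsto (fun z : E3 ↦ scalarH M a (E4.ofTimeSpace 0 z)) (cobounded E3) (𝓝 0) :=
  (isBigOSmooth_scalarH_ofTimeSpace M a 0).tendsto_zero (by norm_num)

end ScalarH

/-! ### The null covector `ℓ` and the null vector `ℓ♯` -/

section Null

variable (a : ℝ)

/-- `ℓ₀ = 1 ∈ O_k(1)`. [cite: arXiv07060622, (34)] -/
theorem isBigOSmooth_nullCovectorFun_zero (k : ℕ) :
    IsBigOSmooth k 0 fun z : E3 ↦ nullCovectorFun a (E4.ofTimeSpace 0 z) 0 :=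
  (isBigOSmooth_const k (1 : ℝ)).congr fun _ ↦ (nullCovectorFun_apply_zero a _).symm

/-- The factor `(r² + a²)⁻¹ = r⁻² (1 + a² r⁻²)⁻¹ ∈ O_k(ρ⁻²)` (far out). [cite: arXiv07060622, (34)] -/
theorem isBigOSmooth_inv_radius_sq_add_sq (k : ℕ) :
    IsBigOSmooth k (-2) fun z : E3 ↦ (radius a (E4.ofTimeSpace 0 z) ^ 2 + a ^ 2)⁻¹ := by
  have hw : IsBigOSmooth k (-2) fun z : E3 ↦ a ^ 2 * (radius a (E4.ofTimeSpace 0 z))⁻¹ ^ 2 := by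
    simpa using (isBigOSmooth_inv_radius_pow_ofTimeSpace a k 2).const_mul (a ^ 2)
  have hw1 : Tendsto (fun z : E3 ↦ 1 + a ^ 2 * (radius a (E4.ofTimeSpace 0 z))⁻¹ ^ 2)
      (cobounded E3) (𝓝 1) := hw.tendsto_const_add (by norm_num) 1
  have hinv := ((isBigOSmooth_const k (1 : ℝ)).add (hw.mono (by norm_num))).inv hw1
  have h2 : IsBigOSmooth k (-2) fun z : E3 ↦ (radius a (E4.ofTimeSpace 0 z))⁻¹ ^ 2 := by
    simpa using isBigOSmooth_inv_radius_pow_ofTimeSpace a k 2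
  have h := h2.mul hinv
  rw [add_zero] at h
  obtain ⟨R₁, hR₁⟩ := exists_radius_of_eventually_cobounded (eventually_radius_ofTimeSpace_pos a)
  refine h.congr_far (R₁ := R₁) fun z hz ↦ ?_
  have hr0 : radius a (E4.ofTimeSpace 0 z) ≠ 0 := (hR₁ z hz).ne'
  have hden : radius a (E4.ofTimeSpace 0 z) ^ 2 + a ^ 2 ≠ 0 := by positivity
  field_simp

/-- `ℓ₁ = (r x + a y)/(r² + a²) ∈ O_k(1)`. [cite: arXiv07060622, (34)] -/
theorem isBigOSmooth_nullCovectorFun_one (k : ℕ) :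
    IsBigOSmooth k 0 fun z : E3 ↦ nullCovectorFun a (E4.ofTimeSpace 0 z) 1 := by
  have hnum : IsBigOSmooth k 2 fun z : E3 ↦ radius a (E4.ofTimeSpace 0 z) * z 0 + a * z 1 := by
    have h1 := (isBigOSmooth_radius_ofTimeSpace a k).mul (isBigOSmooth_coord 0 k)
    rw [show (1 : ℝ) + 1 = 2 by norm_num] at h1
    exact h1.add (((isBigOSmooth_coord 1 k).const_mul a).mono (by norm_num))
  have h := hnum.mul (isBigOSmooth_inv_radius_sq_add_sq a k)
  rw [show (2 : ℝ) + -2 = 0 by norm_num] at h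
  refine h.congr fun z ↦ ?_
  rw [nullCovectorFun_apply_one, ofTimeSpace_zero_apply_one, ofTimeSpace_zero_apply_two,
    div_eq_mul_inv]

/-- `ℓ₂ = (r y − a x)/(r² + a²) ∈ O_k(1)`. [cite: arXiv07060622, (34)] -/
theorem isBigOSmooth_nullCovectorFun_two (k : ℕ) :
    IsBigOSmooth k 0 fun z : E3 ↦ nullCovectorFun a (E4.ofTimeSpace 0 z) 2 := by
  have hnum : IsBigOSmooth k 2 fun z : E3 ↦ radius a (E4.ofTimeSpace 0 z) * z 1 - a * z 0 := by
    have h1 := (isBigOSmooth_radius_ofTimeSpace a k).mul (isBigOSmooth_coord 1 k)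
    rw [show (1 : ℝ) + 1 = 2 by norm_num] at h1
    exact h1.sub (((isBigOSmooth_coord 0 k).const_mul a).mono (by norm_num))
  have h := hnum.mul (isBigOSmooth_inv_radius_sq_add_sq a k)
  rw [show (2 : ℝ) + -2 = 0 by norm_num] at h
  refine h.congr fun z ↦ ?_
  rw [nullCovectorFun_apply_two, ofTimeSpace_zero_apply_one, ofTimeSpace_zero_apply_two,
    div_eq_mul_inv]

/-- `ℓ₃ = z/r ∈ O_k(1)`. [cite: arXiv07060622, (34)] -/
theorem isBigOSmooth_nullCovectorFun_three (k : ℕ) :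
    IsBigOSmooth k 0 fun z : E3 ↦ nullCovectorFun a (E4.ofTimeSpace 0 z) 3 := by
  have h := (isBigOSmooth_coord 2 k).mul (isBigOSmooth_inv_radius_ofTimeSpace a k)
  rw [show (1 : ℝ) + -1 = 0 by norm_num] at h
  refine h.congr fun z ↦ ?_
  rw [nullCovectorFun_apply_three, ofTimeSpace_zero_apply_three, div_eq_mul_inv]

/-- **The components of the Kerr–Schild null covector are symbols of order `0` on the slice**,
for every spin. [cite: arXiv07060622, (34)] -/
theorem isBigOSmooth_nullCovectorFun_ofTimeSpace (k : ℕ) (μ : Fin 4) :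
    IsBigOSmooth k 0 fun z : E3 ↦ nullCovectorFun a (E4.ofTimeSpace 0 z) μ := by
  fin_cases μ
  · exact isBigOSmooth_nullCovectorFun_zero a k
  · exact isBigOSmooth_nullCovectorFun_one a k
  · exact isBigOSmooth_nullCovectorFun_two a k
  · exact isBigOSmooth_nullCovectorFun_three a k

/-- **`ℓ ∈ O_k(1)`** as a covector-valued function on the slice (`ℓ = Σ ℓ_μ dx^μ`).
[cite: arXiv07060622, (34)] -/
theorem isBigOSmooth_nullCovector_ofTimeSpace (k : ℕ) :
    IsBigOSmooth k 0 fun z : E3 ↦ nullCovector a (E4.ofTimeSpace 0 z) :=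
  (IsBigOSmooth.finset_sum (Finset.univ : Finset (Fin 4)) fun μ _ ↦
    (isBigOSmooth_nullCovectorFun_ofTimeSpace a k μ).smul_const (E4.dx μ)).congr fun _ ↦ rfl

/-- **`ℓ♯ ∈ O_k(1)`** as an `E4`-valued function on the slice (`(ℓ♯)^μ = ±ℓ_μ`).
[cite: arXiv07060622, (34)] -/
theorem isBigOSmooth_nullVector_ofTimeSpace (k : ℕ) :
    IsBigOSmooth k 0 fun z : E3 ↦ nullVector a (E4.ofTimeSpace 0 z) := by
  refine IsBigOSmooth.of_apply_E4 fun μ ↦ ?_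
  have h := (isBigOSmooth_nullCovectorFun_ofTimeSpace a k μ).const_mul (if μ = 0 then -1 else 1)
  exact h.congr fun z ↦ (nullVector_apply a _ μ).symm

end Null

/-! ### The metric, the vector `V = −g♯dt*` and the unit normal of the slice -/

section Metric

variable (M a : ℝ)

/-- **`g − η = 2H ℓ ⊗ ℓ ∈ O_k(ρ⁻¹)`** on the slice, as a function valued in bilinear forms on `E4`,
for every spin (`H ∈ O_k(ρ⁻¹)`, `ℓ ∈ O_k(1)`, bilinear Leibniz rule). Cook 2000, §3.2.2
(`h_ij − δ_ij = 2H ℓ_i ℓ_j = O(r⁻¹)`). [cite: Cook2000, §3.2.2] -/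
theorem isBigOSmooth_bilin_sub_ofTimeSpace (k : ℕ) :
    IsBigOSmooth k (-1) fun z : E3 ↦ bilin M a (E4.ofTimeSpace 0 z) - Minkowski.bilin := by
  have hℓ := isBigOSmooth_nullCovector_ofTimeSpace a k
  have ht : IsBigOSmooth k 0 fun z : E3 ↦
      E4.tmul (nullCovector a (E4.ofTimeSpace 0 z)) (nullCovector a (E4.ofTimeSpace 0 z)) :=
    (hℓ.bilin₀ (ContinuousLinearMap.smulRightL ℝ E4 (E4 →L[ℝ] ℝ)) hℓ).congr fun _ ↦ rfl
  have h := ((isBigOSmooth_scalarH_ofTimeSpace M a k).const_mul 2).smul ht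
  rw [add_zero] at h
  refine h.congr fun z ↦ ?_
  rw [bilin]
  abel

/-- `g ∈ O_k(1)` on the slice. [cite: Cook2000, §3.2.2] -/
theorem isBigOSmooth_bilin_ofTimeSpace (k : ℕ) :
    IsBigOSmooth k 0 fun z : E3 ↦ bilin M a (E4.ofTimeSpace 0 z) :=
  ((isBigOSmooth_const k Minkowski.bilin).add
    ((isBigOSmooth_bilin_sub_ofTimeSpace M a k).mono (by norm_num))).congr fun z ↦ by abel

/-- **`V − ∂_{t*} = −2H ℓ♯ ∈ O_k(ρ⁻¹)`** on the slice, `V = −g♯dt* = ∂_{t*} − 2H ℓ♯`.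
Dafermos–Rodnianski arXiv:0811.0354, §5.1; Cook 2000, §3.2.2 (shift `βⁱ = 2Hℓⁱ/(1 + 2H)`).
[cite: Cook2000, §3.2.2] -/
theorem isBigOSmooth_timeVector_sub_ofTimeSpace (k : ℕ) :
    IsBigOSmooth k (-1) fun z : E3 ↦ timeVector M a (E4.ofTimeSpace 0 z) - E4.basisVector 0 := by
  have h := (((isBigOSmooth_scalarH_ofTimeSpace M a k).const_mul 2).smul
    (isBigOSmooth_nullVector_ofTimeSpace a k)).neg
  rw [add_zero] at h
  refine h.congr fun z ↦ ?_
  rw [timeVector]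
  abel

/-- `V ∈ O_k(1)` on the slice. [cite: Cook2000, §3.2.2] -/
theorem isBigOSmooth_timeVector_ofTimeSpace (k : ℕ) :
    IsBigOSmooth k 0 fun z : E3 ↦ timeVector M a (E4.ofTimeSpace 0 z) :=
  ((isBigOSmooth_const k (E4.basisVector 0)).add
    ((isBigOSmooth_timeVector_sub_ofTimeSpace M a k).mono (by norm_num))).congr fun z ↦ by abel

/-- The lapse factor `(1 + 2H)^{-1/2} ∈ O_k(1)` on the slice, with limit `1` (far out
`1 + 2H > 0`, `H → 0`). Cook 2000, §3.2.2 (lapse `α = (1 + 2H)^{-1/2}`). [cite: Cook2000, §3.2.2] -/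
theorem isBigOSmooth_lapse_ofTimeSpace (k : ℕ) :
    IsBigOSmooth k 0 fun z : E3 ↦ (√(1 + 2 * scalarH M a (E4.ofTimeSpace 0 z)))⁻¹ := by
  have hq : IsBigOSmooth k 0 fun z : E3 ↦ 1 + 2 * scalarH M a (E4.ofTimeSpace 0 z) :=
    (isBigOSmooth_const k (1 : ℝ)).add
      (((isBigOSmooth_scalarH_ofTimeSpace M a k).const_mul 2).mono (by norm_num))
  have hq1 : Tendsto (fun z : E3 ↦ 1 + 2 * scalarH M a (E4.ofTimeSpace 0 z)) (cobounded E3) (𝓝 1) :=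
    ((isBigOSmooth_scalarH_ofTimeSpace M a 0).const_mul 2).tendsto_const_add (by norm_num) 1
  exact (hq.sqrt hq1).inv (IsBigOSmooth.tendsto_sqrt_one hq1)

/-- `(1 + 2H)^{-1/2} → 1` along the slice. [cite: Cook2000, §3.2.2] -/
theorem tendsto_lapse_ofTimeSpace :
    Tendsto (fun z : E3 ↦ (√(1 + 2 * scalarH M a (E4.ofTimeSpace 0 z)))⁻¹) (cobounded E3) (𝓝 1) := by
  have hq1 : Tendsto (fun z : E3 ↦ 1 + 2 * scalarH M a (E4.ofTimeSpace 0 z)) (cobounded E3) (𝓝 1) :=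
    ((isBigOSmooth_scalarH_ofTimeSpace M a 0).const_mul 2).tendsto_const_add (by norm_num) 1
  simpa using IsBigOSmooth.tendsto_inv (IsBigOSmooth.tendsto_sqrt_one hq1) one_ne_zero

/-- `(1 + 2H)^{-1/2} − 1 ∈ O_k(ρ⁻¹)`: far out `1 + 2H > 0` and
`(√q)⁻¹ − 1 = (1 − q) (√q)⁻¹ (1 + √q)⁻¹` with `1 − q = −2H ∈ O_k(ρ⁻¹)`. [cite: Cook2000, §3.2.2] -/
theorem isBigOSmooth_lapse_sub_one_ofTimeSpace (k : ℕ) :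
    IsBigOSmooth k (-1) fun z : E3 ↦ (√(1 + 2 * scalarH M a (E4.ofTimeSpace 0 z)))⁻¹ - 1 := by
  set q : E3 → ℝ := fun z ↦ 1 + 2 * scalarH M a (E4.ofTimeSpace 0 z) with hq_def
  have hq1 : Tendsto q (cobounded E3) (𝓝 1) :=
    ((isBigOSmooth_scalarH_ofTimeSpace M a 0).const_mul 2).tendsto_const_add (by norm_num) 1
  have hs := isBigOSmooth_lapse_ofTimeSpace M a k
  have hsq1 : Tendsto (fun z ↦ 1 + √(q z)) (cobounded E3) (𝓝 2) := by
    have h : Tendsto (fun z ↦ (1 : ℝ) + √(q z)) (cobounded E3) (𝓝 ((1 : ℝ) + 1)) :=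
      tendsto_const_nhds.add (IsBigOSmooth.tendsto_sqrt_one hq1)
    rw [show (1 : ℝ) + 1 = 2 by norm_num] at h
    exact h
  have hq0 : IsBigOSmooth k 0 q :=
    (isBigOSmooth_const k (1 : ℝ)).add
      (((isBigOSmooth_scalarH_ofTimeSpace M a k).const_mul 2).mono (by norm_num))
  have hinv2 : IsBigOSmooth k 0 fun z ↦ (1 + √(q z))⁻¹ :=
    ((isBigOSmooth_const k (1 : ℝ)).add (hq0.sqrt hq1)).inv_of_tendsto hsq1 two_ne_zero
  have hnum : IsBigOSmooth k (-1) fun z ↦ 1 - q z := by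
    have h := ((isBigOSmooth_scalarH_ofTimeSpace M a k).const_mul 2).neg
    exact h.congr fun z ↦ by simp only [hq_def]; ring
  have h := (hnum.mul hs).mul hinv2
  rw [show (-1 : ℝ) + 0 + 0 = -1 by norm_num] at h
  -- far out `q > 0`
  obtain ⟨R₁, hR₁⟩ := exists_radius_of_eventually_cobounded
    (hq1.eventually (Ioi_mem_nhds (by norm_num : (0 : ℝ) < 1)))
  refine h.congr_far (R₁ := R₁) fun z hz ↦ ?_
  have hqz : 0 < q z := hR₁ z hz
  simp only [hq_def] at hqz ⊢
  set t := √(1 + 2 * scalarH M a (E4.ofTimeSpace 0 z)) with ht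
  have htpos : 0 < t := Real.sqrt_pos.2 hqz
  have ht0 : t ≠ 0 := htpos.ne'
  have h1 : 1 + t ≠ 0 := by positivity
  have hsq : t * t = 1 + 2 * scalarH M a (E4.ofTimeSpace 0 z) := Real.mul_self_sqrt hqz.le
  symm
  calc t⁻¹ - 1 = (1 - t) * t⁻¹ := by field_simp
    _ = (1 - t) * (1 + t) * t⁻¹ * (1 + t)⁻¹ := by field_simp
    _ = (1 - (1 + 2 * scalarH M a (E4.ofTimeSpace 0 z))) * t⁻¹ * (1 + t)⁻¹ := by
        rw [← hsq]; ring

/-- **The unit normal of the slice is `∂_{t*} + O_k(ρ⁻¹)`**: for the representative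
`ν(z) = (1 + 2H)^{-1/2} V` of `Kerr.sliceNormal` at `(0, z)`,
`ν − ∂_{t*} = (1 + 2H)^{-1/2} (V − ∂_{t*}) + ((1 + 2H)^{-1/2} − 1) ∂_{t*} ∈ O_k(ρ⁻¹)`, every spin.
Cook 2000, §3.2.2. [cite: Cook2000, §3.2.2] -/
theorem isBigOSmooth_sliceNormalRep_sub_ofTimeSpace (k : ℕ) :
    IsBigOSmooth k (-1) fun z : E3 ↦
      (√(1 + 2 * scalarH M a (E4.ofTimeSpace 0 z)))⁻¹ • timeVector M a (E4.ofTimeSpace 0 z) -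
        E4.basisVector 0 := by
  have h1 := (isBigOSmooth_lapse_ofTimeSpace M a k).smul (isBigOSmooth_timeVector_sub_ofTimeSpace M a k)
  have h2 := (isBigOSmooth_lapse_sub_one_ofTimeSpace M a k).smul_const (E4.basisVector 0)
  rw [zero_add] at h1
  refine (h1.add h2).congr fun z ↦ ?_
  rw [smul_sub, sub_smul, one_smul]
  abel

/-- The unit normal representative `(1 + 2H)^{-1/2} V ∈ O_k(1)` on the slice. [cite: Cook2000, §3.2.2] -/
theorem isBigOSmooth_sliceNormalRep_ofTimeSpace (k : ℕ) :
    IsBigOSmooth k 0 fun z : E3 ↦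
      (√(1 + 2 * scalarH M a (E4.ofTimeSpace 0 z)))⁻¹ • timeVector M a (E4.ofTimeSpace 0 z) :=
  ((isBigOSmooth_const k (E4.basisVector 0)).add
    ((isBigOSmooth_sliceNormalRep_sub_ofTimeSpace M a k).mono (by norm_num))).congr fun z ↦ by abel

end Metric

end Kerr

end Literature.Geometry.Lorentzian

end
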